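import Mathlib
import Literature.Probability.RandomPlanarGeometry.ChordalCurveFamilyProofs
import Literature.NumberTheory.LFunctions.XiHeatRayGaussian
import Summits.CriticalPhenomena.SAWScalingLimit.Theorems.SAWRestrictionRigidityAxiomsOfLimitMarkovGenericLevels
import Summits.CriticalPhenomena.SAWScalingLimit.Theorems.SAWRestrictionRigidityAxiomsOfLimitMarkovStrictExtension
import HarnessLib

/-!
# The intrinsic clock of a planar curve

Crux `AxiomsOfLimit` (stmt-CriticalPhenomena-1370), line `registered`, stub `stub_markovOfLimit`:
soft-Markov brick SM4 "intrinsic clock" (lead c4); registered sub-stub `stub_intrinsicClock`.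
Theorems only.

For a radius `R` and a compact set `K ⊆ ℂ` put `G K := ∫ x in closedBall 0 R, exp (-infDist x K)`.
Applied to the range of the explored initial segment of a curve this is the INTRINSIC CLOCK used to
parametrise every curve of the scaling limit by a functional of its past class. This file records
its three properties:

* `IntrinsicClock.abs_integral_sub_integral_le` — `c ↦ G c.range` is Lipschitz on curve classes
  with constant `volume (closedBall 0 R)`: pointwise `|exp (-a) - exp (-b)| ≤ |a - b|` for
  `a, b ≥ 0` (the tree's `Literature.NumberTheory.LFunctions.abs_exp_neg_sub_exp_neg_le`) and
  `|infDist x c.range - infDist x c'.range| ≤ dist c c'` (`Curve.infDist_range_le`);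
* `IntrinsicClock.strictMono_integral_head` — along the heads `t ↦ γ ∘ affineClamp 0 t` of a
  simple curve inside the open ball the clock is strictly increasing: the ranges increase, so the
  integrands increase pointwise, and the new tip `γ t'` is at positive distance from the old
  (compact) range, so the integrand increases strictly on a neighbourhood of `γ t'`, which has
  positive volume;
* `IntrinsicClock.continuous_integral_head` — along the heads of any curve the clock is
  continuous (`continuous_mk_comp_affineClamp` and the Lipschitz bound).

They are assembled in `stub_intrinsicClock`.

References: M. Aizenman, A. Burchard, Duke Math. J. 99 (1999), §2.1 (the curve space);
G. F. Lawler, O. Schramm, W. Werner, Acta Math. 187 (2001), §2 (initial segments). All [folklore].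
-/

noncomputable section

open MeasureTheory Filter Topology Set Metric
open scoped ENNReal unitInterval

namespace Summit.CriticalPhenomena.SAWScalingLimit.Theorems.AxiomsOfLimitMarkov

open Literature.Probability.RandomPlanarGeometry

/-! ### Metric lemmas on ranges of curves, classes and heads -/

section PseudoMetric

variable {E : Type*} [PseudoMetricSpace E]

/-- The distance to the range of a curve changes by at most the curve distance:
`infDist x γ'.range ≤ infDist x γ.range + dist γ γ'`. [folklore] -/
theorem IntrinsicClock.infDist_range_le_infDist_range_add (γ γ' : Curve E) (x : E) :
    infDist x γ'.range ≤ infDist x γ.range + dist γ γ' := by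
  have h : infDist x γ'.range - dist γ γ' ≤ infDist x γ.range := by
    rw [le_infDist γ.range_nonempty]
    rintro _ ⟨t, rfl⟩
    have h1 := infDist_le_infDist_add_dist (s := γ'.range) (x := x) (y := γ t)
    have h2 := Curve.infDist_range_le γ γ' t
    linarith
  linarith

/-- The range of the head `γ ∘ affineClamp 0 t` is `{γ (t s) | s ∈ [0, 1]}`. [folklore] -/
theorem IntrinsicClock.range_head (γ : Curve E) (t : I) :
    (⟨γ.toContinuousMap.comp (Curve.affineClamp 0 t)⟩ : Curve E).range =
      Set.range fun s : I => γ (t * s) := by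
  show Set.range _ = _
  exact congrArg Set.range (funext (StrictExtension.head_apply γ t))

/-- The tip `γ t` belongs to the range of the head `γ ∘ affineClamp 0 t`. [folklore] -/
theorem IntrinsicClock.mem_range_head (γ : Curve E) (t : I) :
    γ t ∈ (⟨γ.toContinuousMap.comp (Curve.affineClamp 0 t)⟩ : Curve E).range := by
  rw [IntrinsicClock.range_head]
  exact ⟨1, congrArg γ (mul_one t)⟩

/-- The ranges of the heads `γ ∘ affineClamp 0 t` increase with `t`. [folklore] -/
theorem IntrinsicClock.range_head_mono (γ : Curve E) {t t' : I} (h : t ≤ t') :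
    (⟨γ.toContinuousMap.comp (Curve.affineClamp 0 t)⟩ : Curve E).range ⊆
      (⟨γ.toContinuousMap.comp (Curve.affineClamp 0 t')⟩ : Curve E).range := by
  rw [IntrinsicClock.range_head, IntrinsicClock.range_head]
  rintro _ ⟨s, rfl⟩
  rcases eq_or_lt_of_le t'.2.1 with ht' | ht'
  · have ht : (t : ℝ) = 0 := le_antisymm (ht' ▸ (Subtype.coe_le_coe.2 h)) t.2.1
    refine ⟨s, congrArg γ (Subtype.ext ?_)⟩
    rw [Set.Icc.coe_mul, Set.Icc.coe_mul, ht, ← ht']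
  · refine ⟨⟨t * s / t', unitInterval.div_mem (mul_nonneg t.2.1 s.2.1) ht'.le
      ((mul_le_of_le_one_right t.2.1 s.2.2).trans (Subtype.coe_le_coe.2 h))⟩,
      congrArg γ (Subtype.ext ?_)⟩
    rw [Set.Icc.coe_mul, Set.Icc.coe_mul]
    show (t' : ℝ) * (t * s / t') = t * s
    field_simp

/-- For a simple curve and `t < t'`, the tip `γ t'` is not on the head `γ ∘ affineClamp 0 t`.
[folklore] -/
theorem IntrinsicClock.notMem_range_head {γ : Curve E} (hγ : γ.IsSimple) {t t' : I} (h : t < t') :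
    γ t' ∉ (⟨γ.toContinuousMap.comp (Curve.affineClamp 0 t)⟩ : Curve E).range := by
  rw [IntrinsicClock.range_head]
  rintro ⟨s, hs⟩
  have hinj : Function.Injective γ := hγ
  exact (unitInterval.mul_le_left.trans_lt h).ne (hinj hs)

end PseudoMetric

section Metric

variable {E : Type*} [MetricSpace E]

/-- The distance to the range of a curve class is `1`-Lipschitz in the class:
`|infDist x c.range - infDist x c'.range| ≤ dist c c'`. [folklore] -/
theorem IntrinsicClock.abs_infDist_sub_infDist_le (c c' : CurveClass E) (x : E) :
    |infDist x c.range - infDist x c'.range| ≤ dist c c' := by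
  obtain ⟨γ, rfl⟩ := CurveClass.surjective_mk c
  obtain ⟨γ', rfl⟩ := CurveClass.surjective_mk c'
  rw [CurveClass.range_mk, CurveClass.range_mk, CurveClass.dist_mk_mk, abs_sub_le_iff]
  constructor
  · have h := IntrinsicClock.infDist_range_le_infDist_range_add γ' γ x
    rw [dist_comm] at h
    linarith
  · linarith [IntrinsicClock.infDist_range_le_infDist_range_add γ γ' x]

end Metric

/-! ### The clock functional `K ↦ ∫ x in closedBall 0 R, exp (-infDist x K)` on `ℂ` -/

/-- The clock integrand `x ↦ exp (-infDist x K)` is continuous. [folklore] -/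
theorem IntrinsicClock.continuous_exp_neg_infDist (K : Set ℂ) :
    Continuous fun x : ℂ => Real.exp (-infDist x K) :=
  Real.continuous_exp.comp (continuous_infDist_pt K).neg

/-- The clock integrand is integrable on every closed ball. [folklore] -/
theorem IntrinsicClock.integrableOn_exp_neg_infDist (R : ℝ) (K : Set ℂ) :
    IntegrableOn (fun x : ℂ => Real.exp (-infDist x K)) (closedBall (0 : ℂ) R) volume :=
  (IntrinsicClock.continuous_exp_neg_infDist K).continuousOn.integrableOn_compact
    (isCompact_closedBall 0 R)

/-- **Lipschitz property of the clock** on curve classes: constant `volume (closedBall 0 R)`.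
[folklore] -/
theorem IntrinsicClock.abs_integral_sub_integral_le (R : ℝ) (c c' : CurveClass ℂ) :
    |(∫ x in closedBall (0 : ℂ) R, Real.exp (-infDist x c.range)) -
        (∫ x in closedBall (0 : ℂ) R, Real.exp (-infDist x c'.range))| ≤
      (volume (closedBall (0 : ℂ) R)).toReal * dist c c' := by
  rw [← integral_sub (IntrinsicClock.integrableOn_exp_neg_infDist R _)
    (IntrinsicClock.integrableOn_exp_neg_infDist R _), mul_comm, ← Real.norm_eq_abs,
    ← measureReal_def]
  refine norm_setIntegral_le_of_norm_le_const measure_closedBall_lt_top fun x _ => ?_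
  rw [Real.norm_eq_abs]
  exact (Literature.NumberTheory.LFunctions.abs_exp_neg_sub_exp_neg_le infDist_nonneg
    infDist_nonneg).trans (IntrinsicClock.abs_infDist_sub_infDist_le c c' x)

/-- The clock `c ↦ ∫ x in closedBall 0 R, exp (-infDist x c.range)` is continuous on curve
classes. [folklore] -/
theorem IntrinsicClock.continuous_integral (R : ℝ) :
    Continuous fun c : CurveClass ℂ =>
      ∫ x in closedBall (0 : ℂ) R, Real.exp (-infDist x c.range) := by
  refine (LipschitzWith.of_dist_le' (K := (volume (closedBall (0 : ℂ) R)).toReal)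
    fun c c' => ?_).continuous
  rw [Real.dist_eq]
  exact IntrinsicClock.abs_integral_sub_integral_le R c c'

/-- **Strict growth of the clock**: if `K ⊆ K'`, `K` is closed and nonempty, and `K'` contains a
point of the open ball `ball 0 R` outside `K`, then the clock of `K` is strictly smaller than the
clock of `K'`. [folklore] -/
theorem IntrinsicClock.integral_lt_integral {R : ℝ} {K K' : Set ℂ} (hK : IsClosed K)
    (hKne : K.Nonempty) (hsub : K ⊆ K') {y : ℂ} (hyK' : y ∈ K') (hyK : y ∉ K)
    (hyR : y ∈ ball (0 : ℂ) R) :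
    (∫ x in closedBall (0 : ℂ) R, Real.exp (-infDist x K)) <
      ∫ x in closedBall (0 : ℂ) R, Real.exp (-infDist x K') := by
  have hle : ∀ x, Real.exp (-infDist x K) ≤ Real.exp (-infDist x K') := fun x =>
    Real.exp_le_exp.2 (neg_le_neg (infDist_le_infDist_of_subset hsub hKne))
  have hcont : Continuous fun x => Real.exp (-infDist x K') - Real.exp (-infDist x K) :=
    (IntrinsicClock.continuous_exp_neg_infDist K').sub (IntrinsicClock.continuous_exp_neg_infDist K)
  have hy : 0 < Real.exp (-infDist y K') - Real.exp (-infDist y K) := by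
    have h1 : infDist y K' = 0 := infDist_zero_of_mem hyK'
    have h2 : 0 < infDist y K := (hK.notMem_iff_infDist_pos hKne).1 hyK
    refine sub_pos.2 (Real.exp_lt_exp.2 ?_)
    rw [h1]
    linarith
  have hint := (IntrinsicClock.integrableOn_exp_neg_infDist R K').sub
    (IntrinsicClock.integrableOn_exp_neg_infDist R K)
  rw [← sub_pos, ← integral_sub (IntrinsicClock.integrableOn_exp_neg_infDist R K')
    (IntrinsicClock.integrableOn_exp_neg_infDist R K),
    setIntegral_pos_iff_support_of_nonneg_ae (Eventually.of_forall fun x => sub_nonneg.2 (hle x))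
      hint]
  have hopen : IsOpen ({x | 0 < Real.exp (-infDist x K') - Real.exp (-infDist x K)} ∩
      ball (0 : ℂ) R) :=
    (isOpen_lt continuous_const hcont).inter isOpen_ball
  refine (hopen.measure_pos volume ⟨y, hy, hyR⟩).trans_le (measure_mono ?_)
  rintro x ⟨hx, hxR⟩
  exact ⟨Function.mem_support.2 (ne_of_gt hx), ball_subset_closedBall hxR⟩

/-- **Strict monotonicity of the clock along the heads of a simple curve** contained in the open
ball `ball 0 R`. [folklore] -/
theorem IntrinsicClock.strictMono_integral_head {R : ℝ} (γ : Curve ℂ) (hγ : γ.IsSimple)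
    (hR : γ.range ⊆ ball (0 : ℂ) R) :
    StrictMono fun t : I => ∫ x in closedBall (0 : ℂ) R,
      Real.exp (-infDist x (⟨γ.toContinuousMap.comp (Curve.affineClamp 0 t)⟩ : Curve ℂ).range) :=
  fun _ t' htt' => IntrinsicClock.integral_lt_integral (Curve.isCompact_range _).isClosed
    (Curve.range_nonempty _) (IntrinsicClock.range_head_mono γ htt'.le)
    (IntrinsicClock.mem_range_head γ t') (IntrinsicClock.notMem_range_head hγ htt') (hR ⟨t', rfl⟩)

/-- **Continuity of the clock along the heads** of any curve. [folklore] -/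
theorem IntrinsicClock.continuous_integral_head (R : ℝ) (γ : Curve ℂ) :
    Continuous fun t : I => ∫ x in closedBall (0 : ℂ) R,
      Real.exp (-infDist x (⟨γ.toContinuousMap.comp (Curve.affineClamp 0 t)⟩ : Curve ℂ).range) := by
  have h1 : Continuous fun t : I =>
      CurveClass.mk (⟨γ.toContinuousMap.comp (Curve.affineClamp 0 t)⟩ : Curve ℂ) :=
    (continuous_mk_comp_affineClamp γ).comp continuous_subtype_val
  refine ((IntrinsicClock.continuous_integral R).comp h1).congr fun t => ?_
  simp only [Function.comp_apply, CurveClass.range_mk]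

/-- **SM4, the intrinsic clock** (crux `AxiomsOfLimit`, registered stub `stub_intrinsicClock`):
for every radius `R > 0`, the clock `K ↦ ∫ x in closedBall 0 R, exp (-infDist x K)` is
(1) Lipschitz in the curve class with constant `volume (closedBall 0 R)`, (2) strictly increasing
along the heads `t ↦ γ ∘ affineClamp 0 t` of a simple curve contained in `ball 0 R`, and
(3) continuous along the heads of any curve. [folklore] -/
theorem stub_intrinsicClock : ∀ (R : ℝ), 0 < R → (∀ c c' : Literature.Probability.RandomPlanarGeometry.CurveClass ℂ, |(∫ x in Metric.closedBall (0:ℂ) R, Real.exp (-Metric.infDist x c.range)) - (∫ x in Metric.closedBall (0:ℂ) R, Real.exp (-Metric.infDist x c'.range))| ≤ (MeasureTheory.volume (Metric.closedBall (0:ℂ) R)).toReal * dist c c') ∧ (∀ γ : Literature.Probability.RandomPlanarGeometry.Curve ℂ, γ.IsSimple → γ.range ⊆ Metric.ball (0:ℂ) R → StrictMono (fun t : unitInterval => ∫ x in Metric.closedBall (0:ℂ) R, Real.exp (-Metric.infDist x ((⟨γ.toContinuousMap.comp (Literature.Probability.RandomPlanarGeometry.Curve.affineClamp 0 t)⟩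 : Literature.Probability.RandomPlanarGeometry.Curve ℂ).range)))) ∧ (∀ γ : Literature.Probability.RandomPlanarGeometry.Curve ℂ, Continuous (fun t : unitInterval => ∫ x in Metric.closedBall (0:ℂ) R, Real.exp (-Metric.infDist x ((⟨γ.toContinuousMap.comp (Literature.Probability.RandomPlanarGeometry.Curve.affineClamp 0 t)⟩ : Literature.Probability.RandomPlanarGeometry.Curve ℂ).range)))) :=
  fun R _ => ⟨IntrinsicClock.abs_integral_sub_integral_le R,
    fun γ hγ hγR => IntrinsicClock.strictMono_integral_head γ hγ hγR,
    fun γ => IntrinsicClock.continuous_integral_head R γ⟩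

end Summit.CriticalPhenomena.SAWScalingLimit.Theorems.AxiomsOfLimitMarkov
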